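import Literature.Topology.PlaneTopology.HalfPlaneEnclosure
import Literature.Topology.PlaneTopology.JordanCurveProofs
import Literature.Probability.RandomPlanarGeometry.HalfPlaneFill
import HarnessLib

/-!
# Touching anchored test sets swallow the origin — helper stub `stub_rangeIsArc_enclose`
(line `marked-point-revisit`, crux `SAWLoopFugacityFlow.SimpleSubseqLimits`,
stmt-CriticalPhenomena-4982; plan `RangeIsArc-PLAN.md`, case (T1), helper H4 of
`stub_rangeIsArc_tests`)

Let `T₊, T₋ ⊆ ℍ̄` be compact, each attached to the lower half-plane (`T ∪ {Im ≤ 0}` connected),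
with the real points of `T₊` positive and those of `T₋` negative. If `T₊ ∩ T₋ ≠ ∅` then `0`
lies in the half-plane fill `hpFill (T₊ ∪ T₋)` (`HalfPlaneFill`): points of `ℍ` near `0` have a
bounded component in `ℍ ∖ (T₊ ∪ T₋)`.

Proof. Adjoin to `T₊` the real segment `[ε₊, R]` carrying its real points, and to `T₋` the
segment `[-R, ε₋]`: both unions are connected (an open partition of `T ∪ segment` would, after
fattening the lower half-plane by the strip `{Im < δ}` below the part of `T` off the first open
set, give an open partition of `T ∪ {Im ≤ 0}`), they meet, so
`C = T₊ ∪ T₋ ∪ [ε₊, R] ∪ [-R, ε₋]` is a continuum of the closed upper half-plane through `±R`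
avoiding `0`; the enclosure theorem `JordanCurveTheorem.exists_isBounded_connectedComponentIn`
(tree, from the Jordan curve theorem `JordanCurveTheorem_holds`) bounds the components near `0`
of `ℍ ∖ C = ℍ ∖ (T₊ ∪ T₋)`.
-/

noncomputable section

open Filter Topology Set Metric Bornology Complex
open Literature.Probability.RandomPlanarGeometry
open UpperHalfPlane (upperHalfPlaneSet)

namespace Summit.CriticalPhenomena.SAWScalingLimit.Theorems.SimpleSubseqLimits.MarkedPointRevisit.ArcRangeEnclose

/-- **Attaching a connected real set carrying the real points keeps an anchored set connected.**
If `T ⊆ ℍ̄` is compact with `T ∪ {Im ≤ 0}` preconnected, and `S` is a preconnected set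
containing every real point of `T`, then `T ∪ S` is preconnected. [folklore] -/
theorem isPreconnected_union_of_anchored {T S : Set ℂ} (hTc : IsCompact T)
    (hTcl : ∀ z ∈ T, 0 ≤ z.im) (hconn : IsPreconnected (T ∪ {z : ℂ | z.im ≤ 0}))
    (hS : IsPreconnected S) (hreal : ∀ z ∈ T, z.im = 0 → z ∈ S) : IsPreconnected (T ∪ S) := by
  intro u v hu hv hcover hTu hTv
  -- if `S` meets both `u` and `v` we are done
  by_cases hSu : (S ∩ u).Nonempty
  · by_cases hSv : (S ∩ v).Nonempty
    · obtain ⟨z, hzS, hz⟩ := hS u v hu hv (subset_union_right.trans hcover) hSu hSv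
      exact ⟨z, Or.inr hzS, hz⟩
    · -- `S ⊆ u`; the part of `T` off `u` is a compact subset of `ℍ`
      have hSsub : S ⊆ u := fun z hz ↦ by
        rcases hcover (Or.inr hz) with h | h
        · exact h
        · exact absurd ⟨z, hz, h⟩ hSv
      exact key hTc hTcl hconn hu hv hcover hTv hSsub hreal
  · have hSsub : S ⊆ v := fun z hz ↦ by
      rcases hcover (Or.inr hz) with h | h
      · exact absurd ⟨z, hz, h⟩ hSu
      · exact h
    have hcover' : T ∪ S ⊆ v ∪ u := by rw [union_comm v u]; exact hcover
    obtain ⟨z, hz, hzv, hzu⟩ := key hTc hTcl hconn hv hu hcover' hTu hSsub hreal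
    exact ⟨z, hz, hzu, hzv⟩
where
  /-- The asymmetric core: `S ⊆ u` and `T ∪ S` meets `v`. [folklore] -/
  key {T S : Set ℂ} (hTc : IsCompact T) (hTcl : ∀ z ∈ T, 0 ≤ z.im)
      (hconn : IsPreconnected (T ∪ {z : ℂ | z.im ≤ 0})) {u v : Set ℂ} (hu : IsOpen u)
      (hv : IsOpen v) (hcover : T ∪ S ⊆ u ∪ v) (hTv : ((T ∪ S) ∩ v).Nonempty) (hSsub : S ⊆ u)
      (hreal : ∀ z ∈ T, z.im = 0 → z ∈ S) : ((T ∪ S) ∩ (u ∩ v)).Nonempty := by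
    by_contra hempty
    rw [Set.not_nonempty_iff_eq_empty] at hempty
    -- `K = T ∖ u` is compact, nonempty, inside `ℍ`
    set K : Set ℂ := T \ u with hK
    have hKc : IsCompact K := hTc.diff hu
    have hKim : ∀ z ∈ K, 0 < z.im := by
      rintro z ⟨hzT, hzu⟩
      rcases (hTcl z hzT).lt_or_eq with h | h
      · exact h
      · exact absurd (hSsub (hreal z hzT h.symm)) hzu
    have hKne : K.Nonempty := by
      obtain ⟨z, hz, hzv⟩ := hTv
      have hzu : z ∉ u := fun hzu ↦ by
        have : z ∈ (T ∪ S) ∩ (u ∩ v) := ⟨hz, hzu, hzv⟩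
        rw [hempty] at this; exact this
      rcases hz with hzT | hzS
      · exact ⟨z, hzT, hzu⟩
      · exact absurd (hSsub hzS) hzu
    obtain ⟨z₀, hz₀K, hz₀⟩ := hKc.exists_isMinOn hKne continuous_im.continuousOn
    set δ : ℝ := z₀.im with hδ
    have hδpos : 0 < δ := hKim z₀ hz₀K
    have hKδ : ∀ z ∈ K, δ ≤ z.im := fun z hz ↦ hz₀ hz
    -- open partition of `T ∪ {Im ≤ 0}`
    set u₁ : Set ℂ := u ∪ {z : ℂ | z.im < δ} with hu₁
    set v₁ : Set ℂ := v ∩ {z : ℂ | 0 < z.im} with hv₁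
    have hu₁o : IsOpen u₁ := hu.union (isOpen_lt continuous_im continuous_const)
    have hv₁o : IsOpen v₁ := hv.inter (isOpen_lt continuous_const continuous_im)
    have hcov : T ∪ {z : ℂ | z.im ≤ 0} ⊆ u₁ ∪ v₁ := by
      rintro z (hzT | hzL)
      · by_cases hzu : z ∈ u
        · exact Or.inl (Or.inl hzu)
        · have hzK : z ∈ K := ⟨hzT, hzu⟩
          rcases hcover (Or.inl hzT) with h | h
          · exact absurd h hzu
          · exact Or.inr ⟨h, hKim z hzK⟩
      · exact Or.inl (Or.inr (lt_of_le_of_lt hzL hδpos))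
    have hne₁ : ((T ∪ {z : ℂ | z.im ≤ 0}) ∩ u₁).Nonempty :=
      ⟨0, Or.inr (by simp), Or.inr (by simpa using hδpos)⟩
    have hne₂ : ((T ∪ {z : ℂ | z.im ≤ 0}) ∩ v₁).Nonempty := by
      obtain ⟨z, hzK⟩ := hKne
      rcases hcover (Or.inl hzK.1) with h | h
      · exact absurd h hzK.2
      · exact ⟨z, Or.inl hzK.1, h, hKim z hzK⟩
    obtain ⟨z, hz, hzu₁, hzv₁⟩ := hconn u₁ v₁ hu₁o hv₁o hcov hne₁ hne₂
    have hzT : z ∈ T := by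
      rcases hz with h | h
      · exact h
      · exact absurd (show 0 < z.im from hzv₁.2) (not_lt.2 h)
    rcases hzu₁ with hzu | hzδ
    · have : z ∈ (T ∪ S) ∩ (u ∩ v) := ⟨Or.inl hzT, hzu, hzv₁.1⟩
      rw [hempty] at this; exact this
    · -- `z ∈ T`, `Im z < δ`, so `z ∈ u`: contradiction as before
      have hzu : z ∈ u := by
        by_contra hzu
        exact absurd (hKδ z ⟨hzT, hzu⟩) (not_le.2 hzδ)
      have : z ∈ (T ∪ S) ∩ (u ∩ v) := ⟨Or.inl hzT, hzu, hzv₁.1⟩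
      rw [hempty] at this; exact this

/-- The real segment `[p, q]` as a subset of `ℂ` is preconnected. [folklore] -/
theorem isPreconnected_ofReal_Icc (p q : ℝ) : IsPreconnected ((fun x : ℝ ↦ (x : ℂ)) '' Icc p q) :=
  isPreconnected_Icc.image _ continuous_ofReal.continuousOn

/-- **Helper stub (T1) of `stub_rangeIsArc_tests` — touching anchored sets swallow `0`.**
Let `Tp, Tm ⊆ ℍ̄` be compact with `Tp ∪ {Im ≤ 0}` and `Tm ∪ {Im ≤ 0}` connected, the real points
of `Tp` positive and those of `Tm` negative. If `Tp` meets `Tm`, then `0 ∈ hpFill (Tp ∪ Tm)`: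
the points `it`, `t → 0⁺`, lie in bounded components of `ℍ ∖ (Tp ∪ Tm)`. Proof: the continuum
`Tp ∪ [εp, R] ∪ Tm ∪ [-R, εm]` (`isPreconnected_union_of_anchored`) of the closed upper
half-plane joins `-R` to `R` and avoids `0`, so the enclosure lemma
`JordanCurveTheorem.exists_isBounded_connectedComponentIn` (with `JordanCurveTheorem_holds`)
applies at `x = 0`; the added real segments do not change `ℍ ∖ ·`. [folklore] -/
theorem stub_rangeIsArc_enclose :
    ∀ (Tp Tm : Set ℂ), IsCompact Tp → IsCompact Tm → Tp ⊆ closure upperHalfPlaneSet →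
      Tm ⊆ closure upperHalfPlaneSet → IsConnected (Tp ∪ {z : ℂ | z.im ≤ 0}) →
      IsConnected (Tm ∪ {z : ℂ | z.im ≤ 0}) → (∀ x : ℝ, (x : ℂ) ∈ Tp → 0 < x) →
      (∀ x : ℝ, (x : ℂ) ∈ Tm → x < 0) → (Tp ∩ Tm).Nonempty → (0 : ℂ) ∈ hpFill (Tp ∪ Tm) := by
  intro Tp Tm hTp hTm hTpcl hTmcl hcp hcm hpos hneg hmeet
  have hcl : closure upperHalfPlaneSet = {z : ℂ | 0 ≤ z.im} := Complex.closure_setOf_lt_im 0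
  have hTpim : ∀ z ∈ Tp, 0 ≤ z.im := fun z hz ↦ by simpa [hcl] using hTpcl hz
  have hTmim : ∀ z ∈ Tm, 0 ≤ z.im := fun z hz ↦ by simpa [hcl] using hTmcl hz
  -- a radius bounding both sets
  obtain ⟨R₀, hR₀⟩ := (hTp.union hTm).isBounded.subset_closedBall 0
  set R : ℝ := |R₀| + 1 with hR
  have hRpos : 0 < R := by rw [hR]; positivity
  have hnormR : ∀ z ∈ Tp ∪ Tm, ‖z‖ < R := fun z hz ↦ by
    have := hR₀ hz
    rw [mem_closedBall, dist_zero_right] at this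
    rw [hR]; linarith [le_abs_self R₀]
  -- real points of `Tp` lie in `[εp, R]` with `εp > 0`, those of `Tm` in `[-R, εm]`, `εm < 0`
  obtain ⟨εp, hεp, hεpR, hεpT⟩ : ∃ εp : ℝ, 0 < εp ∧ εp < R ∧ ∀ x : ℝ, (x : ℂ) ∈ Tp → εp ≤ x := by
    set K : Set ℝ := (fun x : ℝ ↦ (x : ℂ)) ⁻¹' Tp with hK
    have hKc : IsCompact K := by
      refine Metric.isCompact_of_isClosed_isBounded (hTp.isClosed.preimage continuous_ofReal) ?_
      refine isBounded_iff_forall_norm_le.2 ⟨R, fun x hx ↦ ?_⟩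
      have := hnormR x (Or.inl hx)
      rw [norm_real] at this
      exact this.le
    rcases K.eq_empty_or_nonempty with hKe | hKne
    · refine ⟨1 / 2, by norm_num, by rw [hR]; linarith [abs_nonneg R₀], fun x hx ↦ ?_⟩
      have : x ∈ K := hx
      rw [hKe] at this; exact absurd this (Set.notMem_empty x)
    · obtain ⟨x₀, hx₀, hmin⟩ := hKc.exists_isMinOn hKne continuous_id.continuousOn
      refine ⟨x₀, hpos x₀ hx₀, ?_, fun x hx ↦ hmin hx⟩
      have := hnormR x₀ (Or.inl hx₀)
      rw [norm_real, Real.norm_eq_abs] at this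
      linarith [le_abs_self x₀]
  obtain ⟨εm, hεm, hεmR, hεmT⟩ : ∃ εm : ℝ, εm < 0 ∧ -R < εm ∧ ∀ x : ℝ, (x : ℂ) ∈ Tm → x ≤ εm := by
    set K : Set ℝ := (fun x : ℝ ↦ (x : ℂ)) ⁻¹' Tm with hK
    have hKc : IsCompact K := by
      refine Metric.isCompact_of_isClosed_isBounded (hTm.isClosed.preimage continuous_ofReal) ?_
      refine isBounded_iff_forall_norm_le.2 ⟨R, fun x hx ↦ ?_⟩
      have := hnormR x (Or.inr hx)
      rw [norm_real] at this
      exact this.le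
    rcases K.eq_empty_or_nonempty with hKe | hKne
    · refine ⟨-(1 / 2), by norm_num, by rw [hR]; linarith [abs_nonneg R₀], fun x hx ↦ ?_⟩
      have : x ∈ K := hx
      rw [hKe] at this; exact absurd this (Set.notMem_empty x)
    · obtain ⟨x₀, hx₀, hmax⟩ := hKc.exists_isMaxOn hKne continuous_id.continuousOn
      refine ⟨x₀, hneg x₀ hx₀, ?_, fun x hx ↦ hmax hx⟩
      have := hnormR x₀ (Or.inr hx₀)
      rw [norm_real, Real.norm_eq_abs] at this
      linarith [neg_abs_le x₀]
  set Sp : Set ℂ := (fun x : ℝ ↦ (x : ℂ)) '' Icc εp R with hSp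
  set Sm : Set ℂ := (fun x : ℝ ↦ (x : ℂ)) '' Icc (-R) εm with hSm
  -- the continuum `C`
  have hCp : IsPreconnected (Tp ∪ Sp) := by
    refine isPreconnected_union_of_anchored hTp hTpim hcp.isPreconnected
      (isPreconnected_ofReal_Icc εp R) fun z hz hzim ↦ ?_
    have hzre : z = ((z.re : ℝ) : ℂ) := Complex.ext (by simp) (by simp [hzim])
    rw [hzre] at hz ⊢
    refine ⟨z.re, ⟨hεpT _ hz, ?_⟩, rfl⟩
    have := hnormR _ (Or.inl hz)
    rw [norm_real, Real.norm_eq_abs] at this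
    linarith [le_abs_self z.re]
  have hCm : IsPreconnected (Tm ∪ Sm) := by
    refine isPreconnected_union_of_anchored hTm hTmim hcm.isPreconnected
      (isPreconnected_ofReal_Icc (-R) εm) fun z hz hzim ↦ ?_
    have hzre : z = ((z.re : ℝ) : ℂ) := Complex.ext (by simp) (by simp [hzim])
    rw [hzre] at hz ⊢
    refine ⟨z.re, ⟨?_, hεmT _ hz⟩, rfl⟩
    have := hnormR _ (Or.inr hz)
    rw [norm_real, Real.norm_eq_abs] at this
    linarith [neg_abs_le z.re]
  set C : Set ℂ := (Tp ∪ Sp) ∪ (Tm ∪ Sm) with hC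
  have hCconn : IsPreconnected C := by
    obtain ⟨z, hzp, hzm⟩ := hmeet
    exact hCp.union z (Or.inl hzp) (Or.inl hzm) hCm
  have hCc : IsCompact C :=
    (hTp.union (isCompact_Icc.image continuous_ofReal)).union
      (hTm.union (isCompact_Icc.image continuous_ofReal))
  have hCim : ∀ w ∈ C, 0 ≤ w.im := by
    rintro w ((hw | ⟨x, -, rfl⟩) | (hw | ⟨x, -, rfl⟩))
    · exact hTpim w hw
    · simp
    · exact hTmim w hw
    · simp
  have hRC : ((R : ℝ) : ℂ) ∈ C := Or.inl (Or.inr ⟨R, ⟨hεpR.le, le_rfl⟩, rfl⟩)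
  have hmRC : ((-R : ℝ) : ℂ) ∈ C := Or.inr (Or.inr ⟨-R, ⟨le_rfl, hεmR.le⟩, rfl⟩)
  have h0C : ((0 : ℝ) : ℂ) ∉ C := by
    rintro ((h | ⟨x, hx, hx0⟩) | (h | ⟨x, hx, hx0⟩))
    · exact lt_irrefl _ (hpos 0 h)
    · have : x = 0 := by exact_mod_cast (show ((x : ℝ) : ℂ) = ((0 : ℝ) : ℂ) from hx0)
      rw [this] at hx; linarith [hx.1]
    · exact lt_irrefl _ (hneg 0 h)
    · have : x = 0 := by exact_mod_cast (show ((x : ℝ) : ℂ) = ((0 : ℝ) : ℂ) from hx0)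
      rw [this] at hx; linarith [hx.2]
  obtain ⟨r, hr, hbdd⟩ :=
    Literature.Topology.PlaneTopology.JordanCurveTheorem.exists_isBounded_connectedComponentIn
      Literature.Topology.PlaneTopology.JordanCurveTheorem_holds hCc hCconn hCim
      (show -R < (0 : ℝ) by linarith) hRpos hmRC hRC h0C
  -- `ℍ ∖ C = ℍ ∖ (Tp ∪ Tm)`
  have hdiff : upperHalfPlaneSet \ C = upperHalfPlaneSet \ (Tp ∪ Tm) := by
    ext w
    simp only [Set.mem_sdiff, hC]
    constructor
    · rintro ⟨hw, hwC⟩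
      exact ⟨hw, fun h ↦ hwC (h.elim (fun h ↦ Or.inl (Or.inl h)) fun h ↦ Or.inr (Or.inl h))⟩
    · rintro ⟨hw, hwS⟩
      refine ⟨hw, ?_⟩
      rintro ((h | ⟨x, -, rfl⟩) | (h | ⟨x, -, rfl⟩))
      · exact hwS (Or.inl h)
      · exact absurd (show (0 : ℝ) < ((x : ℝ) : ℂ).im from hw) (by simp)
      · exact hwS (Or.inr h)
      · exact absurd (show (0 : ℝ) < ((x : ℝ) : ℂ).im from hw) (by simp)
  -- points `it`, `t → 0⁺`, are off the unbounded component
  rw [hpFill, Metric.mem_closure_iff]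
  intro ε hε
  set t : ℝ := min ε r / 2 with ht
  have htpos : 0 < t := by rw [ht]; positivity
  have htε : t < ε := by
    rw [ht]; linarith [min_le_left ε r]
  have htr : t < r := by
    rw [ht]; linarith [min_le_right ε r]
  refine ⟨(t : ℂ) * I, ⟨?_, ?_⟩, ?_⟩
  · show (0 : ℝ) < ((t : ℂ) * I).im
    simpa using htpos
  · intro hV
    have hwC : (t : ℂ) * I ∈ ball (((0 : ℝ) : ℂ)) r := by
      rw [mem_ball, ofReal_zero, dist_zero_right, norm_mul, norm_real, norm_I, mul_one,
        Real.norm_eq_abs, abs_of_pos htpos]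
      exact htr
    have hb := hbdd _ hwC (by simpa using htpos)
    rw [hdiff] at hb
    exact hV.2 hb
  · rw [dist_comm, dist_zero_right, norm_mul, norm_real, norm_I, mul_one, Real.norm_eq_abs,
      abs_of_pos htpos]
    exact htε

end Summit.CriticalPhenomena.SAWScalingLimit.Theorems.SimpleSubseqLimits.MarkedPointRevisit.ArcRangeEnclose

end
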